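import Summits.CriticalPhenomena.PercolationContinuityZ3.Theorems.PercNearOneGluingNoHeavyLowerTailSahiCoSunflowerAndClosureCert
import Summits.CriticalPhenomena.PercolationContinuityZ3.Theorems.PercNearOneGluingNoHeavyLowerTailSahiCoSunflowerAndClosureCells
import Summits.CriticalPhenomena.PercolationContinuityZ3.Theorems.PercNearOneGluingNoHeavyLowerTailSahiCoSunflowerCylinder
import Mathlib.Tactic.Linarith
import Mathlib.Tactic.Ring
import HarnessLib

/-!
# `NoHeavyLowerTail` (crux stmt-CriticalPhenomena-4575), master-family line P1: the co-sunflower class law is CLOSED UNDER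
# CONJUNCTION OF THE THIRD GENERATOR WITH A COORDINATE — at a SHARED coordinate (`E_3 ≥ p_e · E_3` of the `1`-sections)

Support file (seat `prim-masterthm-p1`, gen 9; `--supports stmt-CriticalPhenomena-4575`).  No definition, no `sorry`, standard axioms.
Memo `run/shared/lean/prim/prim-masterthm/FROM-prim-masterthm-p1-g9-CLAUSE-CLOSURE.md` §2.  Sibling of `…SahiCoSunflowerOrClosure` (the
OR case, a two-term identity) and of `…SahiCoSunflowerAndClosureCert` (the algebraic certificate used here).

SETTING.  Co-sunflower class triple `U = (B ∪ G₃, A ∪ G₃, A ∪ B)` with `G₃ = {e ∈ ω} ∩ K`; `A, B, K` ARBITRARY increasing events (all may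
depend on `e`).  Sections: `U^{e←0} = (B⁰, A⁰, A⁰∪B⁰)` (Sahi's `E_3` there is `X = (2 − μ(A⁰∪B⁰))·Cov(A⁰,B⁰) ≥ 0`, Harris) and
`U^{e←1} = (B¹∪K¹, A¹∪K¹, A¹∪B¹)` — the class triple of the increasing events `(A¹, B¹, K¹)`, value `Y`.  THEOREM (`sahiE_three_andClosure_ge`):
  `E_3(μ_p; U) ≥ p_e · Y + (1 − p_e)² · X`,
from the exact fibre identity `f(t) − tY − (1−t)²X = t(1−t)·S + t(1−t)²·C` (`and_fibre_identity`, pure algebra in the eleven section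
moments) with `C = (μ(B¹∪K¹)−μ(B⁰))(μ(A¹∪K¹)−μ(A⁰))(μ(A¹∪B¹)−μ(A⁰∪B⁰)) ≥ 0` and `S = 3B₂ − 2B₃ ≥ 0` — the latter is the Harris certificate
`SahiCoSunflowerAndClosure.and_E0_cert` (21 Harris-gap × cell-mass terms + a nonnegative cubic in the 18 profile-cell masses), fed here
with the cell decompositions of the sixteen moments (`dec_*`, pointwise indicator identities over the 18 profiles of a point with respect
to `A⁰ ⊆ A¹`, `B⁰ ⊆ B¹`, `K¹`) and seven instances of Harris' inequality between increasing section events.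
COROLLARIES: `sahiE_three_andClosure_nonneg` (`C_3` for the `1`-section triple ⟹ `C_3` for `U`); the GOOD third generators
`𝒢 = {G₃ : ∀ increasing G₁ G₂, 0 ≤ E_3(G₂∪G₃, G₁∪G₃, G₁∪G₂)}` are closed under `K ↦ {e∈ω} ∩ K` for `e` fresh for `K` (`good_andCoord`), hence
under `K ↦ C_S ∩ K`, `C_S = {S ⊆ ω}` (`good_andClause`); with `K = univ ∈ 𝒢` this gives the AND-CLAUSE THEOREM `0 ≤ E_3(G₂ ∪ C_S, G₁ ∪ C_S, G₁∪G₂)`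
for EVERY finite `S` and ALL increasing `G₁, G₂` (`sahiE_three_andClause_nonneg`; gen 7 = `|S| = 1`).  Together with the OR file, `𝒢` contains every
alternating clause chain `C_{S₁} ∩ (O_{S₂} ∪ (C_{S₃} ∩ …))` over disjoint coordinate sets — for `G₁, G₂` sharing those coordinates arbitrarily.
Data (exact census, memo §2): all four Bernstein coefficients of `f` are `≥ 0` at such coordinates and `3B₂ ≥ 2B₃`, `3B₁ ≥ B₀ + B₃` are tight.
HONEST FRAMING: closure theorems for the class; the class law and Kahn's Conjecture 5 remain OPEN. [this work]
-/

noncomputable section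

open scoped Classical

namespace Summit.CriticalPhenomena.PercolationContinuityZ3.Theorems

namespace SahiCoSunflowerAndClosure

open Finset Function
open Literature.Combinatorics.Sahi2008
open Literature.Probability.LatticeModels (sahiE3 prodBernoulli)
open Literature.Probability.Percolation.DecisionTree (ind ind_of_mem ind_of_not_mem ind_nonneg)

variable {ι : Type} [Fintype ι]

/-! ### 1. The fibre identity in the section moments -/

/-- **Fibre identity at an AND-coordinate** (pure algebra, eleven free moment variables): `f(t) − tY − (1−t)²X = t(1−t)·S + t(1−t)²·C` with
`S = 3B₂ − 2B₃` written out (module docstring of `…AndClosureCert`). [this work] -/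
theorem and_fibre_identity (t a0 b0 c0 w0 q p w1 pq qw pw pqw : ℝ) :
    2 * (t * pqw + (1 - t) * c0) + (t * q + (1 - t) * b0) * (t * p + (1 - t) * a0) * (t * w1 + (1 - t) * w0) - ((t * q + (1 - t) * b0) * (t * pw + (1 - t) * a0) + (t * p + (1 - t) * a0) * (t * qw + (1 - t) * b0) + (t * w1 + (1 - t) * w0) * (t * pq + (1 - t) * c0))
      - (t * (2 * pqw + q * p * w1 - (q * pw + p * qw + w1 * pq)) + (1 - t) ^ 2 * ((2 - w0) * (c0 - a0 * b0)))
      = t * (1 - t) * ((2 - w0) * (c0 - a0 * b0) + (-(1 - w1) * (a0 * (q - b0) + b0 * (p - a0)) + w0 * (q - b0) * (p - a0) + (q - b0) * (pw - p * w1) + (p - a0) * (qw - q * w1) + (w1 - w0) * ((pq - p * q) - (c0 - a0 * b0))) + (q - b0) * (p - a0) * (w1 - w0))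
        + t * (1 - t) ^ 2 * ((q - b0) * (p - a0) * (w1 - w0)) := by
  ring

/-- From `S ≥ 0`, `t ∈ [0,1]` and the three monotonicities `b0 ≤ q`, `a0 ≤ p`, `w0 ≤ w1`: `t·Y + (1−t)²·X ≤ f(t)`. [this work] -/
theorem and_fibre_ge {t a0 b0 c0 w0 q p w1 pq qw pw pqw : ℝ} (ht0 : 0 ≤ t) (ht1 : t ≤ 1)
    (hS : 0 ≤ ((2 - w0) * (c0 - a0 * b0) + (-(1 - w1) * (a0 * (q - b0) + b0 * (p - a0)) + w0 * (q - b0) * (p - a0) + (q - b0) * (pw - p * w1) + (p - a0) * (qw - q * w1) + (w1 - w0) * ((pq - p * q) - (c0 - a0 * b0))) + (q - b0) * (p - a0) * (w1 - w0)))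
    (hdf : b0 ≤ q) (hdg : a0 ≤ p) (hdh : w0 ≤ w1) :
    t * (2 * pqw + q * p * w1 - (q * pw + p * qw + w1 * pq)) + (1 - t) ^ 2 * ((2 - w0) * (c0 - a0 * b0))
      ≤ 2 * (t * pqw + (1 - t) * c0) + (t * q + (1 - t) * b0) * (t * p + (1 - t) * a0) * (t * w1 + (1 - t) * w0) - ((t * q + (1 - t) * b0) * (t * pw + (1 - t) * a0) + (t * p + (1 - t) * a0) * (t * qw + (1 - t) * b0) + (t * w1 + (1 - t) * w0) * (t * pq + (1 - t) * c0)) := by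
  rw [← sub_nonneg, and_fibre_identity]
  have h1t : 0 ≤ 1 - t := sub_nonneg.2 ht1
  exact add_nonneg (mul_nonneg (mul_nonneg ht0 h1t) hS)
    (mul_nonneg (mul_nonneg ht0 (pow_nonneg h1t 2))
      (mul_nonneg (mul_nonneg (sub_nonneg.2 hdf) (sub_nonneg.2 hdg)) (sub_nonneg.2 hdh)))

/-! ### 3. The theorem -/

/-- **THEOREM (AND-coordinate domination, `e` shared).**  For every finite cube, product weight `p`, coordinate `e` and ALL increasing
`A, B, K` (they may depend on `e`), with `X⁰ = X^{e←0}`, `X¹ = X^{e←1}`: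
`p_e · E_3(μ_p; B¹∪K¹, A¹∪K¹, A¹∪B¹) + (1 − p_e)²·(2 − μ(A⁰∪B⁰))(μ(B⁰∩A⁰) − μ(A⁰)μ(B⁰)) ≤ E_3(μ_p; B ∪ ({e∈ω} ∩ K), A ∪ ({e∈ω} ∩ K), A ∪ B)`. [this work] -/
theorem sahiE_three_andClosure_ge (p : ι → unitInterval) (e : ι) {A B K : Set (Set ι)} (hA : IsUpperSet A) (hB : IsUpperSet B)
    (hK : IsUpperSet K) :
    (p e : ℝ) * sahiE (bernoulliWeight p) 3
        ![ind (secAt e true B ∪ secAt e true K), ind (secAt e true A ∪ secAt e true K), ind (secAt e true A ∪ secAt e true B)]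
      + (1 - (p e : ℝ)) ^ 2 * ((2 - ex (bernoulliWeight p) (ind (secAt e false A ∪ secAt e false B)))
          * (ex (bernoulliWeight p) (ind (secAt e false B ∩ secAt e false A))
            - ex (bernoulliWeight p) (ind (secAt e false A)) * ex (bernoulliWeight p) (ind (secAt e false B))))
      ≤ sahiE (bernoulliWeight p) 3 ![ind (B ∪ ({ω : Set ι | e ∈ ω} ∩ K)), ind (A ∪ ({ω : Set ι | e ∈ ω} ∩ K)), ind (A ∪ B)] := by
  set G : Set (Set ι) := {ω : Set ι | e ∈ ω} ∩ K with hG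
  set A0 := secAt e false A
  set B0 := secAt e false B
  set A1 := secAt e true A
  set B1 := secAt e true B
  set K1 := secAt e true K
  set t : ℝ := (p e : ℝ) with ht
  set μ := bernoulliWeight p with hμ
  have ht0 : 0 ≤ t := (p e).2.1
  have ht1 : t ≤ 1 := (p e).2.2
  have sG1 : secAt e true G = K1 := by
    rw [hG, secAt_inter, SahiCombDisjunct.secAt_true_coord, Set.univ_inter]
  have sG0 : secAt e false G = ∅ := by
    rw [hG, secAt_inter, SahiCombDisjunct.secAt_false_coord, Set.empty_inter]
  -- the seven moments of the functional, conditioned on `e`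
  have e1 : ex μ (ind (B ∪ G)) = t * ex μ (ind (B1 ∪ K1)) + (1 - t) * ex μ (ind B0) := by
    rw [ex_ind_eq_secAt p e, SahiCombDisjunct.secAt_union, SahiCombDisjunct.secAt_union, sG1, sG0, Set.union_empty]
  have e2 : ex μ (ind (A ∪ G)) = t * ex μ (ind (A1 ∪ K1)) + (1 - t) * ex μ (ind A0) := by
    rw [ex_ind_eq_secAt p e, SahiCombDisjunct.secAt_union, SahiCombDisjunct.secAt_union, sG1, sG0, Set.union_empty]
  have e3 : ex μ (ind (A ∪ B)) = t * ex μ (ind (A1 ∪ B1)) + (1 - t) * ex μ (ind (A0 ∪ B0)) := by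
    rw [ex_ind_eq_secAt p e, SahiCombDisjunct.secAt_union, SahiCombDisjunct.secAt_union]
  have e12 : ex μ (ind ((B ∪ G) ∩ (A ∪ G))) = t * ex μ (ind ((B1 ∪ K1) ∩ (A1 ∪ K1))) + (1 - t) * ex μ (ind (B0 ∩ A0)) := by
    rw [ex_ind_eq_secAt p e, secAt_inter, secAt_inter, SahiCombDisjunct.secAt_union, SahiCombDisjunct.secAt_union,
      SahiCombDisjunct.secAt_union, SahiCombDisjunct.secAt_union, sG1, sG0, Set.union_empty, Set.union_empty]
  have e13 : ex μ (ind ((B ∪ G) ∩ (A ∪ B))) = t * ex μ (ind ((B1 ∪ K1) ∩ (A1 ∪ B1))) + (1 - t) * ex μ (ind B0) := by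
    rw [ex_ind_eq_secAt p e, secAt_inter, secAt_inter, SahiCombDisjunct.secAt_union, SahiCombDisjunct.secAt_union,
      SahiCombDisjunct.secAt_union, SahiCombDisjunct.secAt_union, sG1, sG0, Set.union_empty,
      Set.inter_eq_left.2 (Set.subset_union_right : B0 ⊆ A0 ∪ B0)]
  have e23 : ex μ (ind ((A ∪ G) ∩ (A ∪ B))) = t * ex μ (ind ((A1 ∪ K1) ∩ (A1 ∪ B1))) + (1 - t) * ex μ (ind A0) := by
    rw [ex_ind_eq_secAt p e, secAt_inter, secAt_inter, SahiCombDisjunct.secAt_union, SahiCombDisjunct.secAt_union,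
      SahiCombDisjunct.secAt_union, SahiCombDisjunct.secAt_union, sG1, sG0, Set.union_empty,
      Set.inter_eq_left.2 (Set.subset_union_left : A0 ⊆ A0 ∪ B0)]
  have e123 : ex μ (ind ((B ∪ G) ∩ (A ∪ G) ∩ (A ∪ B))) =
      t * ex μ (ind ((B1 ∪ K1) ∩ (A1 ∪ K1) ∩ (A1 ∪ B1))) + (1 - t) * ex μ (ind (B0 ∩ A0)) := by
    rw [ex_ind_eq_secAt p e, secAt_inter, secAt_inter, secAt_inter, secAt_inter, SahiCombDisjunct.secAt_union,
      SahiCombDisjunct.secAt_union, SahiCombDisjunct.secAt_union, SahiCombDisjunct.secAt_union, SahiCombDisjunct.secAt_union,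
      SahiCombDisjunct.secAt_union, sG1, sG0, Set.union_empty, Set.union_empty,
      Set.inter_eq_left.2 ((Set.inter_subset_right : B0 ∩ A0 ⊆ A0).trans (Set.subset_union_left : A0 ⊆ A0 ∪ B0))]
  -- sections are increasing and nested
  have hA0u : IsUpperSet A0 := isUpperSet_secAt e false hA
  have hB0u : IsUpperSet B0 := isUpperSet_secAt e false hB
  have hA1u : IsUpperSet A1 := isUpperSet_secAt e true hA
  have hB1u : IsUpperSet B1 := isUpperSet_secAt e true hB
  have hK1u : IsUpperSet K1 := isUpperSet_secAt e true hK
  have hA01 : A0 ⊆ A1 := secAt_false_subset_true hA e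
  have hB01 : B0 ⊆ B1 := secAt_false_subset_true hB e
  have hQu : IsUpperSet (B1 ∪ K1) := hB1u.union hK1u
  have hPu : IsUpperSet (A1 ∪ K1) := hA1u.union hK1u
  have hW1u : IsUpperSet (A1 ∪ B1) := hA1u.union hB1u
  have hQWu : IsUpperSet ((B1 ∪ K1) ∩ (A1 ∪ B1)) := IsUpperSet.inter hQu hW1u
  have hPWu : IsUpperSet ((A1 ∪ K1) ∩ (A1 ∪ B1)) := IsUpperSet.inter hPu hW1u
  -- the seven Harris inequalities of the certificate
  have hH1 : ex μ (ind B0) * ex μ (ind A0) ≤ ex μ (ind (B0 ∩ A0)) := harris_ex_ind p hB0u hA0u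
  have hH2 : ex μ (ind B0) * ex μ (ind ((A1 ∪ K1) ∩ (A1 ∪ B1))) ≤ ex μ (ind (B0 ∩ ((A1 ∪ K1) ∩ (A1 ∪ B1)))) :=
    harris_ex_ind p hB0u hPWu
  have hH3 : ex μ (ind B0) * ex μ (ind (A1 ∪ K1)) ≤ ex μ (ind (B0 ∩ (A1 ∪ K1))) := harris_ex_ind p hB0u hPu
  have hH4 : ex μ (ind ((B1 ∪ K1) ∩ (A1 ∪ B1))) * ex μ (ind A0) ≤ ex μ (ind ((B1 ∪ K1) ∩ (A1 ∪ B1) ∩ A0)) :=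
    harris_ex_ind p hQWu hA0u
  have hH5 : ex μ (ind ((B1 ∪ K1) ∩ (A1 ∪ B1))) * ex μ (ind ((A1 ∪ K1) ∩ (A1 ∪ B1)))
      ≤ ex μ (ind ((B1 ∪ K1) ∩ (A1 ∪ B1) ∩ ((A1 ∪ K1) ∩ (A1 ∪ B1)))) := harris_ex_ind p hQWu hPWu
  have hH6 : ex μ (ind (B1 ∪ K1)) * ex μ (ind A0) ≤ ex μ (ind ((B1 ∪ K1) ∩ A0)) := harris_ex_ind p hQu hA0u
  have hH7 : ex μ (ind (B1 ∪ K1)) * ex μ (ind (A1 ∪ K1)) ≤ ex μ (ind ((B1 ∪ K1) ∩ (A1 ∪ K1))) := harris_ex_ind p hQu hPu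
  -- total mass of the 18 profile cells
  have hsum := dec_univ μ A0 A1 B0 B1 K1 hA01 hB01
  rw [SahiCombDisjunct.ex_ind_univ] at hsum
  -- the certificate `S ≥ 0`
  have hS := and_E0_cert
    (h000 := ex_ind_nonneg' p (A1ᶜ ∩ B1ᶜ ∩ K1ᶜ))
    (h001 := ex_ind_nonneg' p (A1ᶜ ∩ B1ᶜ ∩ K1))
    (h010 := ex_ind_nonneg' p (A1ᶜ ∩ (B1 \ B0) ∩ K1ᶜ))
    (h011 := ex_ind_nonneg' p (A1ᶜ ∩ (B1 \ B0) ∩ K1))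
    (h020 := ex_ind_nonneg' p (A1ᶜ ∩ B0 ∩ K1ᶜ))
    (h021 := ex_ind_nonneg' p (A1ᶜ ∩ B0 ∩ K1))
    (h100 := ex_ind_nonneg' p ((A1 \ A0) ∩ B1ᶜ ∩ K1ᶜ))
    (h101 := ex_ind_nonneg' p ((A1 \ A0) ∩ B1ᶜ ∩ K1))
    (h110 := ex_ind_nonneg' p ((A1 \ A0) ∩ (B1 \ B0) ∩ K1ᶜ))
    (h111 := ex_ind_nonneg' p ((A1 \ A0) ∩ (B1 \ B0) ∩ K1))
    (h120 := ex_ind_nonneg' p ((A1 \ A0) ∩ B0 ∩ K1ᶜ))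
    (h121 := ex_ind_nonneg' p ((A1 \ A0) ∩ B0 ∩ K1))
    (h200 := ex_ind_nonneg' p (A0 ∩ B1ᶜ ∩ K1ᶜ))
    (h201 := ex_ind_nonneg' p (A0 ∩ B1ᶜ ∩ K1))
    (h210 := ex_ind_nonneg' p (A0 ∩ (B1 \ B0) ∩ K1ᶜ))
    (h211 := ex_ind_nonneg' p (A0 ∩ (B1 \ B0) ∩ K1))
    (h220 := ex_ind_nonneg' p (A0 ∩ B0 ∩ K1ᶜ))
    (h221 := ex_ind_nonneg' p (A0 ∩ B0 ∩ K1))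
    hsum.symm
    (dec_a0 μ A0 A1 B0 B1 K1 hA01 hB01)
    (dec_b0 μ A0 A1 B0 B1 K1 hA01 hB01)
    (dec_c0 μ A0 A1 B0 B1 K1 hA01 hB01)
    (dec_w0 μ A0 A1 B0 B1 K1 hA01 hB01)
    (dec_q μ A0 A1 B0 B1 K1 hA01 hB01)
    (dec_p μ A0 A1 B0 B1 K1 hA01 hB01)
    (dec_w1 μ A0 A1 B0 B1 K1 hA01 hB01)
    (dec_pq μ A0 A1 B0 B1 K1 hA01 hB01)
    (dec_qw μ A0 A1 B0 B1 K1 hA01 hB01)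
    (dec_pw μ A0 A1 B0 B1 K1 hA01 hB01)
    (dec_ib0pw μ A0 A1 B0 B1 K1 hA01 hB01)
    (dec_ib0p μ A0 A1 B0 B1 K1 hA01 hB01)
    (dec_iqwa0 μ A0 A1 B0 B1 K1 hA01 hB01)
    (dec_iqwpw μ A0 A1 B0 B1 K1 hA01 hB01)
    (dec_iqa0 μ A0 A1 B0 B1 K1 hA01 hB01)
    hH1 hH2 hH3 hH4 hH5 hH6 hH7
  -- monotonicities
  have hdf : ex μ (ind B0) ≤ ex μ (ind (B1 ∪ K1)) := Pointwise.ex_ind_le_of_subset p (hB01.trans Set.subset_union_left)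
  have hdg : ex μ (ind A0) ≤ ex μ (ind (A1 ∪ K1)) := Pointwise.ex_ind_le_of_subset p (hA01.trans Set.subset_union_left)
  have hdh : ex μ (ind (A0 ∪ B0)) ≤ ex μ (ind (A1 ∪ B1)) := by
    have h := Pointwise.ex_secAt_true_sub_false_nonneg p e (hA.union hB)
    rw [SahiCombDisjunct.secAt_union, SahiCombDisjunct.secAt_union] at h
    linarith
  -- assemble
  have key := and_fibre_ge (pqw := ex μ (ind ((B1 ∪ K1) ∩ (A1 ∪ K1) ∩ (A1 ∪ B1)))) ht0 ht1 hS hdf hdg hdh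
  rw [sahiE_three, sahiE_three]
  simp only [ind_mul_ind_eq_inter]
  rw [e1, e2, e3, e12, e13, e23, e123]
  linarith [key]

/-- **AND-closure of the class law at a shared coordinate.**  If the co-sunflower triple of the `1`-sections `(A¹, B¹, K¹)` satisfies
Sahi's `C_3`, so does the triple of `(A, B, {e∈ω} ∩ K)`. [this work] -/
theorem sahiE_three_andClosure_nonneg (p : ι → unitInterval) (e : ι) {A B K : Set (Set ι)} (hA : IsUpperSet A) (hB : IsUpperSet B)
    (hK : IsUpperSet K)
    (h1 : 0 ≤ sahiE (bernoulliWeight p) 3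
      ![ind (secAt e true B ∪ secAt e true K), ind (secAt e true A ∪ secAt e true K), ind (secAt e true A ∪ secAt e true B)]) :
    0 ≤ sahiE (bernoulliWeight p) 3 ![ind (B ∪ ({ω : Set ι | e ∈ ω} ∩ K)), ind (A ∪ ({ω : Set ι | e ∈ ω} ∩ K)), ind (A ∪ B)] := by
  have h := sahiE_three_andClosure_ge p e hA hB hK
  have hX : 0 ≤ (2 - ex (bernoulliWeight p) (ind (secAt e false A ∪ secAt e false B)))
      * (ex (bernoulliWeight p) (ind (secAt e false B ∩ secAt e false A))
        - ex (bernoulliWeight p) (ind (secAt e false A)) * ex (bernoulliWeight p) (ind (secAt e false B))) := by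
    refine mul_nonneg (by linarith [ex_bernoulliWeight_ind_le_one p (secAt e false A ∪ secAt e false B)]) (sub_nonneg.2 ?_)
    have hh := harris_ex_ind p (isUpperSet_secAt e false hB) (isUpperSet_secAt e false hA)
    linarith
  have ht := mul_nonneg (p e).2.1 h1
  have hsq := mul_nonneg (pow_nonneg (sub_nonneg.2 (p e).2.2) 2) hX
  linarith

/-! ### 4. Good third generators: closure under AND-ing fresh coordinates; the AND-clause theorem -/

/-- **Closure of the GOOD third generators under `K ↦ {e∈ω} ∩ K` (`e` fresh for `K`, arbitrary for `G₁, G₂`).** [this work] -/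
theorem good_andCoord (p : ι → unitInterval) (e : ι) {K : Set (Set ι)} (hK : IsUpperSet K) (hKe : secAt e true K = K)
    (hgood : ∀ G₁ G₂ : Set (Set ι), IsUpperSet G₁ → IsUpperSet G₂ →
      0 ≤ sahiE (bernoulliWeight p) 3 ![ind (G₂ ∪ K), ind (G₁ ∪ K), ind (G₁ ∪ G₂)]) :
    ∀ G₁ G₂ : Set (Set ι), IsUpperSet G₁ → IsUpperSet G₂ →
      0 ≤ sahiE (bernoulliWeight p) 3 ![ind (G₂ ∪ ({ω : Set ι | e ∈ ω} ∩ K)), ind (G₁ ∪ ({ω : Set ι | e ∈ ω} ∩ K)), ind (G₁ ∪ G₂)] := by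
  intro G₁ G₂ h₁ h₂
  refine sahiE_three_andClosure_nonneg p e h₁ h₂ hK ?_
  rw [hKe]
  exact hgood _ _ (isUpperSet_secAt e true h₁) (isUpperSet_secAt e true h₂)

omit [Fintype ι] in
/-- The AND-clause `C_S = {ω | ∀ e ∈ S, e ∈ ω}` of a finite set of coordinates ignores every other coordinate. [folklore] -/
theorem secAt_andClause_of_not_mem {S : Finset ι} {e : ι} (he : e ∉ S) (b : Bool) :
    secAt e b {ω : Set ι | ∀ f ∈ S, f ∈ ω} = {ω : Set ι | ∀ f ∈ S, f ∈ ω} := by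
  ext ω
  rw [mem_secAt]
  simp only [Set.mem_setOf_eq]
  cases b
  · simp only [forceAt, cond_false, Set.mem_sdiff, Set.mem_singleton_iff]
    constructor
    · intro h f hf; exact (h f hf).1
    · intro h f hf; exact ⟨h f hf, fun hfe => he (hfe ▸ hf)⟩
  · simp only [forceAt, cond_true, Set.mem_insert_iff]
    constructor
    · intro h f hf
      rcases h f hf with hfe | hfω
      · exact absurd hf (hfe ▸ he)
      · exact hfω
    · intro h f hf; exact Or.inr (h f hf)

omit [Fintype ι] in
/-- `C_{insert e S} = {e ∈ ω} ∩ C_S`. [folklore] -/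
theorem andClause_insert (S : Finset ι) (e : ι) :
    {ω : Set ι | ∀ f ∈ insert e S, f ∈ ω} = {ω : Set ι | e ∈ ω} ∩ {ω : Set ι | ∀ f ∈ S, f ∈ ω} := by
  ext ω
  simp only [Set.mem_setOf_eq, Finset.mem_insert, Set.mem_inter_iff, forall_eq_or_imp]

omit [Fintype ι] in
/-- The AND-clause of a finite set of coordinates is increasing. [folklore] -/
theorem isUpperSet_andClause (S : Finset ι) : IsUpperSet {ω : Set ι | ∀ f ∈ S, f ∈ ω} := by
  intro ω ω' hle h f hf
  exact hle (h f hf)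

/-- **Closure under AND-ing a whole clause of fresh coordinates.**  If `K` ignores every coordinate of `S` and is a good third generator,
so is `C_S ∩ K` (induction on `S` with `good_andCoord`). [this work] -/
theorem good_andClause (p : ι → unitInterval) (S : Finset ι) {K : Set (Set ι)} (hK : IsUpperSet K)
    (hKS : ∀ e ∈ S, ∀ b, secAt e b K = K)
    (hgood : ∀ G₁ G₂ : Set (Set ι), IsUpperSet G₁ → IsUpperSet G₂ →
      0 ≤ sahiE (bernoulliWeight p) 3 ![ind (G₂ ∪ K), ind (G₁ ∪ K), ind (G₁ ∪ G₂)]) :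
    ∀ G₁ G₂ : Set (Set ι), IsUpperSet G₁ → IsUpperSet G₂ →
      0 ≤ sahiE (bernoulliWeight p) 3
        ![ind (G₂ ∪ ({ω : Set ι | ∀ e ∈ S, e ∈ ω} ∩ K)), ind (G₁ ∪ ({ω : Set ι | ∀ e ∈ S, e ∈ ω} ∩ K)), ind (G₁ ∪ G₂)] := by
  induction S using Finset.induction_on with
  | empty =>
    intro G₁ G₂ h₁ h₂
    have h0 : ({ω : Set ι | ∀ e ∈ (∅ : Finset ι), e ∈ ω} ∩ K) = K := by
      ext ω; simp
    rw [h0]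
    exact hgood G₁ G₂ h₁ h₂
  | @insert e S he ih =>
    intro G₁ G₂ h₁ h₂
    have hS : ∀ f ∈ S, ∀ b, secAt f b K = K := fun f hf b => hKS f (Finset.mem_insert_of_mem hf) b
    have hrec := ih hS
    have hset : ({ω : Set ι | ∀ f ∈ insert e S, f ∈ ω} ∩ K) =
        {ω : Set ι | e ∈ ω} ∩ ({ω : Set ι | ∀ f ∈ S, f ∈ ω} ∩ K) := by
      rw [andClause_insert, Set.inter_assoc]
    rw [hset]
    refine good_andCoord p e ((isUpperSet_andClause S).inter hK) ?_ hrec G₁ G₂ h₁ h₂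
    rw [secAt_inter, secAt_andClause_of_not_mem he, hKS e (Finset.mem_insert_self e S)]

/-- `E_3(μ; 1, 1, h) = 0`: two constant members. [folklore] -/
theorem sahiE_three_univ_univ (p : ι → unitInterval) (W : Set (Set ι)) :
    sahiE (bernoulliWeight p) 3 ![ind (Set.univ : Set (Set ι)), ind (Set.univ : Set (Set ι)), ind W] = 0 := by
  rw [sahiE_three]
  simp only [ind_mul_ind_eq_inter, Set.univ_inter, SahiCombDisjunct.ex_ind_univ]
  ring

/-- **THE AND-CLAUSE THEOREM.**  For every finite set of coordinates `S` (`C_S = {ω | ∀ e ∈ S, e ∈ ω}`) and ALL increasing `G₁, G₂` (which may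
use the coordinates of `S`): `0 ≤ E_3(μ_p; G₂ ∪ C_S, G₁ ∪ C_S, G₁ ∪ G₂)` — Sahi's `C_3` for the co-sunflower triple of `(G₁, G₂, C_S)`; by the
reflection `ω ↦ ωᶜ`, Kahn's Conjecture 5 for the complements of the sunflower `(F₂ ∩ O_S, F₁ ∩ O_S, F₁ ∩ F₂)`, `O_S` an OR-clause, all
increasing `F₁, F₂`.  (`|S| = 1` is gen 7's `sahiE_three_orCoord_nonneg`.)  Base `K = univ` (`E_3(1,1,h) = 0`) and `good_andClause`. [this work] -/
theorem sahiE_three_andClause_nonneg (p : ι → unitInterval) (S : Finset ι) {G₁ G₂ : Set (Set ι)} (h₁ : IsUpperSet G₁)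
    (h₂ : IsUpperSet G₂) :
    0 ≤ sahiE (bernoulliWeight p) 3
      ![ind (G₂ ∪ {ω : Set ι | ∀ e ∈ S, e ∈ ω}), ind (G₁ ∪ {ω : Set ι | ∀ e ∈ S, e ∈ ω}), ind (G₁ ∪ G₂)] := by
  have h := good_andClause p S (K := (Set.univ : Set (Set ι))) isUpperSet_univ
    (fun e _ b => by cases b <;> rfl)
    (fun G₁ G₂ _ _ => by rw [Set.union_univ, Set.union_univ, sahiE_three_univ_univ]) G₁ G₂ h₁ h₂
  simpa only [Set.inter_univ] using h

end SahiCoSunflowerAndClosure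

end Summit.CriticalPhenomena.PercolationContinuityZ3.Theorems
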